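import Mathlib

/-!
# The terminating Pfaff–Saalschütz ₃F₂ summation via a Wilf–Zeilberger certificate

(Dougall's terminating very-well-poised ₅F₄, by the same method, is in `HypergeometricDougall.lean`.)

HONEST FRAMING: systematic search; no irrationality claim unless certified.

Provenance: written by planner gen-1 g4 (staged `HOME/lean/HypergeometricSummation.lean`, sha256 `d1174a317937…`),
filed verbatim (plus docstrings; split at 400 lines) by typer g6.

For a field `K` of characteristic zero, `a b c : K` and `m : ℕ`, with `(x)_k` the rising factorial
(`ph x k = (ascPochhammer K k).eval x`):

  `Σ_{k=0}^{m} (-m)_k (a)_k (b)_k / (k! (c)_k (1+a+b-c-m)_k) · (c)_m (c-a-b)_m = (c-a)_m (c-b)_m`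

(`pfaffSaalschutz`; quotient form `pfaffSaalschutz_div`), under the natural non-vanishing hypotheses on the
denominators.  The proof is Zeilberger's: the WZ-type certificate
`G(m,k) = k (k+c-1)(k+d-1) (-m-1)_k (a)_k (b)_k / ((m+1) k! (c)_k (d)_k)`, `d = 1+a+b-c-m`, gives
`(c+m)(c-a-b+m) F(m+1,k) - (c-a+m)(c-b+m) F(m,k) = G(m,k+1) - G(m,k)` (`wz_eq_zero`, `wz_eq_succ`, generic in
`x = -m`), whence the first-order recurrence `saalSum_rec` and the closed form by induction.

This is the summation used four times in the uniform proof of the CF-Q closed form for the Brown–Zudilin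
leading coefficient on the eight-parameter wedge (pub-zeta5 PROOF-NOTES-g4 §9), and in the face lemmas (§7′).

-/

open Polynomial Finset

namespace Summit.KontsevichZagierPeriods.Zeta5Search.Hypergeometric

variable {K : Type*} [Field K] [CharZero K]

/-- rising factorial `(x)_k` as a field element -/
noncomputable def ph (x : K) (k : ℕ) : K := (ascPochhammer K k).eval x

omit [CharZero K] in
/-- `(x)_0 = 1`. -/
theorem ph_zero (x : K) : ph x 0 = 1 := by simp [ph]

omit [CharZero K] in
/-- `(x)_1 = x`. -/
theorem ph_one (x : K) : ph x 1 = x := by simp [ph]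

omit [CharZero K] in
/-- `(x)_{k+1} = (x)_k (x+k)`. -/
theorem ph_succ (x : K) (k : ℕ) : ph x (k + 1) = ph x k * (x + k) := by
  unfold ph; exact ascPochhammer_succ_eval k x

omit [CharZero K] in
/-- `(y)_k (y+k) = y (y+1)_k` -/
theorem ph_shift (y : K) (k : ℕ) : ph y k * (y + k) = y * ph (y + 1) k := by
  unfold ph
  have h1 : (ascPochhammer K (k + 1)).eval y = (ascPochhammer K k).eval y * (y + k) :=
    ascPochhammer_succ_eval k y
  have h2 : (ascPochhammer K (k + 1)).eval y = y * (ascPochhammer K k).eval (y + 1) := by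
    rw [ascPochhammer_succ_left, eval_mul, eval_X, eval_comp, eval_add, eval_X, eval_one]
  rw [← h1, h2]

omit [CharZero K] in
/-- `(-m)_{m+1} = 0` -/
theorem ph_neg_nat_succ (m : ℕ) : ph (-(m : K)) (m + 1) = 0 := by
  rw [ph_succ]; ring

/-- generic balanced-type summand `(x)_k (a)_k (b)_k / (k! (c)_k (d)_k)` -/
noncomputable def term (x a b c d : K) (k : ℕ) : K :=
  ph x k * ph a k * ph b k / ((k.factorial : K) * ph c k * ph d k)

/-- the WZ companion `g k = G(m,k+1)`:  `(x-1)_{k+1} (a)_{k+1} (b)_{k+1} / ((1-x) k! (c)_k (d)_k)` -/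
noncomputable def wz (x a b c d : K) (k : ℕ) : K :=
  ph (x - 1) (k + 1) * ph a (k + 1) * ph b (k + 1) / ((1 - x) * (k.factorial : K) * ph c k * ph d k)

omit [CharZero K] in
/-- WZ equation at `k = 0`. -/
theorem wz_eq_zero (x a b c d : K) (h1x : 1 - x ≠ 0) :
    (c - x) * (c - a - b - x) * term (x - 1) a b c (d - 1) 0 - (c - a - x) * (c - b - x) * term x a b c d 0
      = wz x a b c d 0 := by
  simp only [term, wz, ph_zero, ph_one, Nat.factorial_zero, Nat.cast_one, zero_add]
  field_simp
  ring

/-- WZ equation at `k + 1` (generic `x`; balanced condition `d = 1 + a + b - c + x`). -/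
theorem wz_eq_succ (x a b c d : K) (k : ℕ) (hbal : d = 1 + a + b - c + x) (h1x : 1 - x ≠ 0)
    (hc : ph c (k + 1) ≠ 0) (hd0 : ph d (k + 1) ≠ 0) (hd1 : ph (d - 1) (k + 1) ≠ 0) (hdm : d - 1 ≠ 0) :
    (c - x) * (c - a - b - x) * term (x - 1) a b c (d - 1) (k + 1) - (c - a - x) * (c - b - x) * term x a b c d (k + 1)
      = wz x a b c d (k + 1) - wz x a b c d k := by
  -- split the non-vanishing hypotheses
  have hc' : ph c k ≠ 0 ∧ c + k ≠ 0 := by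
    rw [ph_succ] at hc; exact mul_ne_zero_iff.mp hc
  have hd0' : ph d k ≠ 0 ∧ d + k ≠ 0 := by
    rw [ph_succ] at hd0; exact mul_ne_zero_iff.mp hd0
  have hd1' : ph (d - 1) k ≠ 0 ∧ d - 1 + k ≠ 0 := by
    rw [ph_succ] at hd1; exact mul_ne_zero_iff.mp hd1
  obtain ⟨hc1, hc2⟩ := hc'
  obtain ⟨hd01, hd02⟩ := hd0'
  obtain ⟨hd11, hd12⟩ := hd1'
  have hfk : (k.factorial : K) ≠ 0 := by exact_mod_cast k.factorial_ne_zero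
  have hfk1 : ((k + 1).factorial : K) ≠ 0 := by exact_mod_cast (k + 1).factorial_ne_zero
  -- the two shift relations, solved for `ph x k` and `ph d k`
  have hx1 : x - 1 ≠ 0 := by intro h; apply h1x; linear_combination -h
  have rel1 : ph x k = ph (x - 1) k * (x - 1 + k) / (x - 1) := by
    rw [eq_div_iff hx1]
    have := ph_shift (x - 1) k
    rw [show x - 1 + 1 = x by ring] at this
    linear_combination -this
  have rel2 : ph d k = ph (d - 1) k * (d - 1 + k) / (d - 1) := by
    rw [eq_div_iff hdm]
    have := ph_shift (d - 1) k
    rw [show d - 1 + 1 = d by ring] at this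
    linear_combination -this
  simp only [term, wz]
  simp only [ph_succ, Nat.factorial_succ, Nat.cast_mul, Nat.cast_add, Nat.cast_one]
  rw [rel1, rel2]
  subst hbal
  field_simp
  ring


omit [CharZero K] in
/-- `(y)_{k+1} = y (y+1)_k`. -/
theorem ph_succ_left (y : K) (k : ℕ) : ph y (k + 1) = y * ph (y + 1) k := by
  unfold ph
  rw [ascPochhammer_succ_left, eval_mul, eval_X, eval_comp, eval_add, eval_X, eval_one]

/-- WZ boundary relation at the top (`x = -m`, `k = m + 1`): the extra term of `S(m+1)` cancels the telescoped remainder. -/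
theorem wz_top (a b c d : K) (m : ℕ) (hbal : d = 1 + a + b - c - m)
    (hc : ph c (m + 1) ≠ 0) (hd0 : ph d m ≠ 0) (hdm : d - 1 ≠ 0) :
    (c + m) * (c - a - b + m) * term (-(m : K) - 1) a b c (d - 1) (m + 1) + wz (-(m : K)) a b c d m = 0 := by
  have hc' : ph c m ≠ 0 ∧ c + m ≠ 0 := by
    rw [ph_succ] at hc; exact mul_ne_zero_iff.mp hc
  obtain ⟨hc1, hc2⟩ := hc'
  have hfm : (m.factorial : K) ≠ 0 := by exact_mod_cast m.factorial_ne_zero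
  have hm1 : (m : K) + 1 ≠ 0 := by exact_mod_cast m.succ_ne_zero
  have hm1' : (1 : K) + m ≠ 0 := by rw [add_comm]; exact hm1
  have hm1'' : (1 : K) - (-(m : K)) ≠ 0 := by rw [sub_neg_eq_add]; exact hm1'
  have rel : ph (d - 1) (m + 1) = (d - 1) * ph d m := by
    rw [ph_succ_left, show d - 1 + 1 = d by ring]
  simp only [term, wz]
  rw [rel]
  simp only [ph_succ, Nat.factorial_succ, Nat.cast_mul, Nat.cast_add, Nat.cast_one]
  subst hbal
  field_simp
  ring

/-- the terminating balanced sum `₃F₂(-m, a, b; c, 1 + a + b - c - m; 1)` -/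
noncomputable def saalSum (a b c : K) (m : ℕ) : K :=
  ∑ k ∈ range (m + 1), term (-(m : K)) a b c (1 + a + b - c - m) k

/-- first-order recurrence of the Saalschütz sum (Zeilberger / WZ). -/
theorem saalSum_rec (a b c : K) (m : ℕ) (hc : ∀ k ≤ m + 1, ph c k ≠ 0)
    (hd0 : ∀ k ≤ m, ph (1 + a + b - c - m) k ≠ 0) (hd1 : ∀ k ≤ m + 1, ph (1 + a + b - c - m - 1) k ≠ 0) :
    (c + m) * (c - a - b + m) * saalSum a b c (m + 1) = (c - a + m) * (c - b + m) * saalSum a b c m := by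
  set d : K := 1 + a + b - c - m with hd_def
  have hbal : d = 1 + a + b - c + (-(m : K)) := by rw [hd_def]; ring
  have hbal' : d = 1 + a + b - c - m := hd_def
  have h1x : (1 : K) - (-(m : K)) ≠ 0 := by
    have hm1 : (m : K) + 1 ≠ 0 := by exact_mod_cast m.succ_ne_zero
    rw [sub_neg_eq_add, add_comm]; exact hm1
  have hdm : d - 1 ≠ 0 := by
    have := hd1 1 (by omega); rwa [ph_one] at this
  -- rewrite `saalSum (m+1)` over `range (m+1)` plus the top term, with arguments in `x - 1`, `d - 1` shape
  have eS : saalSum a b c (m + 1) = (∑ k ∈ range (m + 1), term (-(m : K) - 1) a b c (d - 1) k)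
      + term (-(m : K) - 1) a b c (d - 1) (m + 1) := by
    unfold saalSum
    have e1 : (-((m + 1 : ℕ) : K)) = -(m : K) - 1 := by push_cast; ring
    have e2 : (1 + a + b - c - ((m + 1 : ℕ) : K)) = d - 1 := by rw [hd_def]; push_cast; ring
    rw [e1, e2, Finset.sum_range_succ]
  -- telescoping over `range (m+1)`
  have H1 : ∑ k ∈ range (m + 1), ((c - (-(m : K))) * (c - a - b - (-(m : K))) * term (-(m : K) - 1) a b c (d - 1) k
      - (c - a - (-(m : K))) * (c - b - (-(m : K))) * term (-(m : K)) a b c d k) = wz (-(m : K)) a b c d m := by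
    rw [Finset.sum_range_succ']
    have h0 := wz_eq_zero (-(m : K)) a b c d h1x
    have hs : ∀ k ∈ range m, (c - (-(m : K))) * (c - a - b - (-(m : K))) * term (-(m : K) - 1) a b c (d - 1) (k + 1)
        - (c - a - (-(m : K))) * (c - b - (-(m : K))) * term (-(m : K)) a b c d (k + 1)
        = wz (-(m : K)) a b c d (k + 1) - wz (-(m : K)) a b c d k := by
      intro k hk
      have hk' : k + 1 ≤ m := Nat.succ_le_of_lt (mem_range.mp hk)
      exact wz_eq_succ (-(m : K)) a b c d k hbal h1x (hc (k + 1) (by omega)) (hd0 (k + 1) hk')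
        (hd1 (k + 1) (by omega)) hdm
    rw [Finset.sum_congr rfl hs, Finset.sum_range_sub, h0]
    ring
  have H2 := wz_top a b c d m hbal' (hc (m + 1) le_rfl) (hd0 m le_rfl) hdm
  have H1' : (c + m) * (c - a - b + m) * (∑ k ∈ range (m + 1), term (-(m : K) - 1) a b c (d - 1) k)
      - (c - a + m) * (c - b + m) * saalSum a b c m = wz (-(m : K)) a b c d m := by
    rw [← H1, Finset.sum_sub_distrib, ← Finset.mul_sum, ← Finset.mul_sum]
    unfold saalSum
    ring
  rw [eS]
  linear_combination H1' + H2

/-- **Pfaff–Saalschütz summation** (terminating form), denominators cleared: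
`₃F₂(-m, a, b; c, 1+a+b-c-m; 1) · (c)_m (c-a-b)_m = (c-a)_m (c-b)_m`. -/
theorem pfaffSaalschutz (a b c : K) (m : ℕ) (hc : ∀ k ≤ m, ph c k ≠ 0)
    (hd : ∀ j ≤ m, ∀ k ≤ j, ph (1 + a + b - c - j) k ≠ 0) :
    saalSum a b c m * (ph c m * ph (c - a - b) m) = ph (c - a) m * ph (c - b) m := by
  induction m with
  | zero =>
    simp [saalSum, term, ph_zero]
  | succ m ih =>
    have ih' := ih (fun k hk => hc k (by omega)) (fun j hj k hk => hd j (by omega) k hk)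
    have hd1 : ∀ k ≤ m + 1, ph (1 + a + b - c - m - 1) k ≠ 0 := by
      intro k hk
      have h := hd (m + 1) le_rfl k hk
      have e : (1 + a + b - c - ((m + 1 : ℕ) : K)) = 1 + a + b - c - m - 1 := by push_cast; ring
      rwa [e] at h
    have REC := saalSum_rec a b c m (fun k hk => hc k hk) (fun k hk => hd m (by omega) k hk) hd1
    simp only [ph_succ]
    linear_combination (ph c m * ph (c - a - b) m) * REC + ((c - a + m) * (c - b + m)) * ih'


/-- Pfaff–Saalschütz in quotient form. -/
theorem pfaffSaalschutz_div (a b c : K) (m : ℕ) (hc : ∀ k ≤ m, ph c k ≠ 0)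
    (hd : ∀ j ≤ m, ∀ k ≤ j, ph (1 + a + b - c - j) k ≠ 0) (hcab : ph (c - a - b) m ≠ 0) :
    saalSum a b c m = ph (c - a) m * ph (c - b) m / (ph c m * ph (c - a - b) m) := by
  have h := pfaffSaalschutz a b c m hc hd
  have hne : ph c m * ph (c - a - b) m ≠ 0 := mul_ne_zero (hc m le_rfl) hcab
  rw [eq_div_iff hne, h]

end Summit.KontsevichZagierPeriods.Zeta5Search.Hypergeometric
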